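import Summits.ResolutionOfSingularities.ResolutionOfSingularities.Theorems.FrobeniusClosingPatchingRelPerfectMonomialPolyhedraGame
import HarnessLib

/-!
# Crux `PatchingRelPerfect` (stmt-ResolutionOfSingularities-16161), chain w52 — TargetsF3 (m)
# «M2-strong», COMBINATORIAL HALF, file 1m: the game with MARKING `m` (Hironaka's version),
# the LOCAL WIN, POSITIONAL exceptional indices, and the Route-K target

[OURS · L1 W5.2 · res-L1-w52-plan-1 RULING M2 06:34:44Z + RULING «Route K approved» 07:37:28Z;
interface with res-L1-w52-stub-4 (INTERFACE NOTE 06:46:33Z: «win must be LOCAL», «state =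
positions»); fact-free; nothing here is a statement of the manuscript under review]

File 1 (`…MonomialPolyhedraGame`, p507620) fixed permissibility at weight `≥ 1` and the end
condition `Principal` (least member at every stratum — the total-transform notion).  Route K runs the
tree's functorial order reduction `𝓑𝓜𝓞_m` for an arbitrary marking `m ≥ 1`, whose output is the
sharper, LOCAL end condition «`cosupp (I_r, m) = ∅`», i.e. at every stratum some member has weight
`< m`; and the scheme dictionary indexes the exceptional divisors POSITIONALLY (the new divisor of a
state with `n` boundary members is number `n`).  This file types exactly that:

* `PermissibleM m s J` — `J` a non-empty stratum with `m ≤ |α_J|` for every member (`E_J ⊆ cosupp(I,m)`);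
  `permissibleM_one_iff` (= file 1's `Permissible`).
* `WonM m s` — at every stratum some member has weight `< m`; `wonM_one_iff` (= stub-4's `LocalWin`:
  a member vanishing identically on the stratum); `principal_of_wonM_one`.
* `WinnableAll m s` — won, or some permissible `J` such that for EVERY fresh name `e ∉ B` the moved
  state `move s J e m` (controlled bookkeeping `c = m`) is again `WinnableAll` (label-independence is
  free for Route K and lets every consumer pick its own naming policy);
  `WinnablePos m s` — the POSITIONAL policy `e := #B` (for `B = range n`: `e = n`);
  `WinnableAll.winnablePos`, `WinnableAll.winnable_one` (⇒ file 1's `Winnable 1`, hence `Winnable 0`).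
* `RouteKTarget m := ∀ s, s.WF → WinnableAll m s` and
  `globalPermissiblePolyhedraGame_of_routeKTarget : RouteKTarget 1 → GlobalPermissiblePolyhedraGame`.
-/

-- `Summit.<Summit>.<Sub>.Theorems` with `Sub = Summit` (single-conjunct summit, D-0017)
set_option linter.dupNamespace false

namespace Summit.ResolutionOfSingularities.ResolutionOfSingularities.Theorems

namespace PolyhedraGame

open Finset

/-! ## Marking `m` -/

/-- [OURS · W5.2 M2-strong] Permissibility with marking `m`: `J` is a non-empty stratum and every
member has weight `≥ m` on `J` (`E_J ⊆ cosupp (I, m)`, Hironaka's rule `Σ_{j∈J} x_j ≥ 1` after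
scaling by `m`). -/
def PermissibleM (m : ℕ) (s : State) (J : Finset ℕ) : Prop :=
  J ∈ s.Str ∧ J.Nonempty ∧ ∀ α ∈ s.A, m ≤ weight J α

/-- [OURS] Marking `1` is file 1's permissibility. -/
theorem permissibleM_one_iff (s : State) (J : Finset ℕ) : PermissibleM 1 s J ↔ Permissible s J :=
  Iff.rfl

/-- [OURS · W5.2 M2-strong] The LOCAL WIN with marking `m`: at every stratum some member has weight
`< m` (the order of the controlled transform dropped below the marking everywhere:
`cosupp (I, m) = ∅`). -/
def WonM (m : ℕ) (s : State) : Prop :=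
  ∀ T ∈ s.Str, ∃ α ∈ s.A, weight T α < m

/-- [OURS] With marking `1` the local win says: at every stratum some member vanishes identically
there (res-L1-w52-stub-4's `LocalWin`, the end criterion of `monomialSum_eq_top_of_forall_…`). -/
theorem wonM_one_iff (s : State) :
    WonM 1 s ↔ ∀ T ∈ s.Str, ∃ α ∈ s.A, ∀ i ∈ T, α i = 0 := by
  refine forall₂_congr fun T _ => exists_congr fun α => and_congr_right fun _ => ?_
  rw [Nat.lt_one_iff, weight, Finset.sum_eq_zero_iff]

/-- [OURS] A local win with marking `1` is a principal state (the vanishing member is least). -/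
theorem principal_of_wonM_one {s : State} (h : WonM 1 s) : Principal s := by
  intro T hT
  obtain ⟨α₀, hα₀, h0⟩ := (wonM_one_iff s).mp h T hT
  exact ⟨α₀, hα₀, fun α _ i hi => by rw [h0 i hi]; exact Nat.zero_le _⟩

/-! ## Winnability with marking `m`: all fresh names / positional names -/

/-- [OURS · W5.2 M2-strong] `WinnableAll m s`: the state is won (marking `m`), or there is a
permissible centre `J` such that for EVERY fresh exceptional name `e ∉ B` the moved state (controlled
bookkeeping `c = m`) is again `WinnableAll m`.  The quantification over all names makes the notion
independent of the consumer's naming policy. -/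
inductive WinnableAll (m : ℕ) : State → Prop
  /-- a won state -/
  | done {s : State} : WonM m s → WinnableAll m s
  /-- a permissible move, good under every fresh name -/
  | step {s : State} (J : Finset ℕ) :
      PermissibleM m s J → (∀ e, e ∉ s.B → WinnableAll m (move s J e m)) → WinnableAll m s

/-- [OURS · W5.2 M2-strong] `WinnablePos m s`: winnability with the POSITIONAL naming policy — the
exceptional index of a move from a state with `#B` boundary indices is `#B` (for `B = range n` this is
`n`, the position of the new divisor appended to the boundary list). -/
inductive WinnablePos (m : ℕ) : State → Prop
  /-- a won state -/
  | done {s : State} : WonM m s → WinnablePos m s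
  /-- a permissible move with the positional name -/
  | step {s : State} (J : Finset ℕ) :
      PermissibleM m s J → s.B.card ∉ s.B → WinnablePos m (move s J s.B.card m) → WinnablePos m s

/-- [OURS] For `B = range n`, the positional index `#B = n` is fresh. -/
theorem card_notMem_of_eq_range {s : State} {n : ℕ} (h : s.B = Finset.range n) : s.B.card ∉ s.B := by
  rw [h, Finset.card_range]
  simp

/-- [OURS] The boundary indices after a move. -/
@[simp] theorem move_B (s : State) (J : Finset ℕ) (e c : ℕ) : (move s J e c).B = insert e s.B := rfl

/-- [OURS] A positional move keeps the boundary indices an initial segment. -/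
theorem move_B_eq_range {s : State} {n : ℕ} (h : s.B = Finset.range n) (J : Finset ℕ) (c : ℕ) :
    (move s J s.B.card c).B = Finset.range (n + 1) := by
  rw [move_B, h, Finset.card_range, Finset.range_add_one]

/-- [OURS] **All-names winnability gives positional winnability** on states whose boundary indices
form an initial segment `range n` (preserved by positional moves). -/
theorem WinnableAll.winnablePos {m : ℕ} {s : State} (h : WinnableAll m s) :
    ∀ n : ℕ, s.B = Finset.range n → WinnablePos m s := by
  induction h with
  | done hw => exact fun _ _ => WinnablePos.done hw
  | step J hJ _ ih =>
    intro n hn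
    have he : _ := card_notMem_of_eq_range hn
    exact WinnablePos.step J hJ he (ih _ he (n + 1) (move_B_eq_range hn J m))

/-- [OURS] A fresh name always exists: one more than every live index. -/
theorem sup_succ_notMem (s : State) : s.B.sup id + 1 ∉ s.B := by
  intro h
  have h2 : id (s.B.sup id + 1) ≤ s.B.sup id := Finset.le_sup (f := id) h
  simp only [id] at h2
  omega

/-- [OURS] **All-names winnability with marking `1` gives file 1's `Winnable 1`** (choose any fresh
name; a local win is principal), hence `Winnable 0` (`winnable_zero_of_winnable_one`). -/
theorem WinnableAll.winnable_one {s : State} (h : WinnableAll 1 s) : Winnable 1 s := by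
  induction h with
  | done hw => exact Winnable.done (principal_of_wonM_one hw)
  | step J hJ _ ih =>
    exact Winnable.step J _ ((permissibleM_one_iff _ J).mp hJ) (sup_succ_notMem _)
      (ih _ (sup_succ_notMem _))

/-- [OURS] Corollary: all-names winnability with marking `1` gives a total-transform win. -/
theorem WinnableAll.winnable_zero {s : State} (h : WinnableAll 1 s) : Winnable 0 s :=
  winnable_zero_of_winnable_one h.winnable_one

/-! ## The Route-K target -/

/-- [OURS · W5.2 M2-strong · Route K target, NOT proved here] With marking `m`, every well-formed state
is `WinnableAll m`: finitely many blow-ups of strata inside `cosupp (I, m)` (controlled transform with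
marking `m`) reach a local win.  Route K (res-L1-w52-plan-1 RULING 07:37:28Z) derives it from the
tree's functorial order reduction in characteristic zero (`Kollar2007.MarkedOrderReductionInDim`)
by realising the state as a monomial ideal on a toric open of `𝔸^B_ℚ` and reading the torus-stable
centres back as strata.  A `Prop`; consumers take it as a hypothesis until discharged. -/
def RouteKTarget (m : ℕ) : Prop := ∀ s : State, s.WF → WinnableAll m s

/-- [OURS] The Route-K target with marking `1` discharges the target of file 1. -/
theorem globalPermissiblePolyhedraGame_of_routeKTarget (h : RouteKTarget 1) :
    GlobalPermissiblePolyhedraGame :=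
  fun s hs => (h s hs).winnable_zero

/-- [OURS] The Route-K target with marking `m` gives positional winnability for list-indexed states
(the shape consumed by the scheme dictionary). -/
theorem winnablePos_of_routeKTarget {m : ℕ} (h : RouteKTarget m) (s : State) (hs : s.WF) (n : ℕ)
    (hn : s.B = Finset.range n) : WinnablePos m s :=
  (h s hs).winnablePos n hn

end PolyhedraGame

end Summit.ResolutionOfSingularities.ResolutionOfSingularities.Theorems
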